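import Literature.MathematicalPhysics.QuantumFieldTheory.Balaban1983to89.B9Eq342BlockDecayWeightedSum
import Literature.MathematicalPhysics.QuantumFieldTheory.Balaban1983to89.B9Eq342SupNormBootstrapWeightedChain

/-!
# `Balaban1983to89.B9Eq342SupNormDecayFromBlockDecay` — T. Bałaban, *Propagators for lattice gauge theories in a background field*, Commun. Math.
# Phys. **99** (1985) 389–434 [Balaban1985BackgroundPropagators] Thm 3.1 (3.42) p. 397, FIRST ENTRY WITH ITS DECAY FACTOR *«|(G′(U)λ)(x)| ≤ B₀e^{−δ₀d(y,y′)}|λ|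
# for x ∈ Δ(y), y ∈ Λ_j, supp λ ⊂ Δ(y′)»*: **THE DECAYED VALUE ROW FROM THE LETTERS — the weighted Kato bootstrap with `k` dominations
# (`B9Eq342SupNormBootstrapWeightedChain`) fed by the (D-E) plumbing (`B9Eq342BlockDecayWeightedSum`): for a solution `u = Gf` of a covariant
# equation `(Lu)(x) = f(x) − q(x)` with contractive transporters, a source `f` supported in ONE block `v` (`‖f(x)‖ ≤ F`, `‖f‖ ≤ √μ·F`), a BLOCK-LOCAL
# penalty `‖q(x)‖ ≤ p₂‖P_{π x}u‖`, the BLOCK DECAY `‖P_y∘G∘P_v‖ ≤ C_E e^{−κδ(y,v)}`, a supersolution weight `λW ≤ (L₀+m₀)W` centred at the output site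
# (`W(x₀) = 1`, `e^{κ₁δ(π x₀, π x)} ≤ M·W(x)`) and the decayed free letter at `x₀` (`φ_k(x₀) ≤ C₃√(Σ_y w(y)φ₀(y)²∕W(y))` for `k`-chains):
# `‖u(x₀)‖ ≤ (M(1 + p₂C_E√μ)λ⁻¹·Σ_{l<k}(m₀∕λ)^l + m₀^k·C₃·C_E·√(MS)·√μ)·e^{−a·δ(π x₀, v)}·F` for every rate `0 ≤ a ≤ κ`, `a ≤ κ₁`,
# `Σ_{y′}e^{−(κ₁−2a)δ(y,y′)} ≤ S`; on the lattice (`π = blockCoord`, `δ = d_m`, `2a < κ₁`) with `S = K_d(κ₁ − 2a)` VOLUME-FREE** — [folklore] composition BY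
# NAME over an ABSTRACT block map `π` (one step: `π = blockCoord` on `T_{Lm}`; `k` steps: the big-block map on `T_{L^{k}m}`), typed for the NE9 row OWNER's storey (D)
# «decay in `d(y,y′)`» (plan v10 `t4/b2b-balaban-t4-ne9-p1/g89/SUP-NORM-PROGRAMME.md` §5 (D-A)).  ONE-STEP CONSUMER: none needed — the OWNER's
# `B9Eq342GreenPrimeSupBoundDecay` (t4-ne9-p1 g90) composes the same letters directly at `G′(U)`; TOWER CONSUMER: the OWNER's (D-A)k at `G′_k(U) = GpOfUk` on
# `towerP L m (n+1)` (`π :=` the big-block map, `hq :=` the tower penalty of `B9Eq324PenaltyBlockLocal` §2, `hFS :=` `B5Eq129FreeResolventDecayedLetterSite.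
# chain_apply_le_weighted_site` at `P := towerP L m (n+1)`) — filed at the OWNER's word W-4 (journal) for that use

statement-level skeleton of published theorems with citation tags; proofs where landed; nothing here is a claim about the Yang–Mills mass gap

CITATION HEADER (lean-in-tree rule).  Audit cell `pub-balaban`, sub-cell `t4`, BINDER row NE9; filed by NE9 formalisation-swarm LEAF PROVER 06
(`b2b-balaban-t4-ne9-formalise-leaf-06`, gen 71; the road-B8″ block-decay lineage named among the first refusals of storey (D) in plan v10 §5, author of
(D-E)).  Source READ in the held text [Balaban1985BackgroundPropagators] (`paper:balaban1985-cmp99-background-propagators`, journal page = PDF page + 388):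
p. 397 (3.39) *«Thus we have the supremum norms |λ| = max sup|λ_μ(x)|»*, Thm 3.1 *«There exist positive constants M₁, δ₀, a₀, B₀ dependent on d and L only …
the operator G′(U) (a = 1) satisfies the inequalities |(G′(U)λ)(x)|, … ≤ B₀e^{−δ₀d(y,y′)}|λ| for x ∈ Δ(y), y ∈ Λ_j, supp λ ⊂ Δ(y′) (3.42)»*, p. 398 *«We will
prove the above theorem by constructing a random walk representation»*, p. 399 (3.49) (the unit-lattice blocks `Δ(y)`), p. 415 *«random walk expansion»*.
NOTHING of that proof is reproduced and NOTHING printed is used as a hypothesis: the cell's storey (D) substitutes positivity (Kato domination,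
[DodziukMathai2006] §1 BY NAME through `B9Eq323KatoDomination`), the Agmon∕Combes–Thomas supersolution weight (METHOD only; P. D. Hislop, I. M. Sigal,
*Introduction to Spectral Theory*, Ch. 3) and the chain's `L²` block decay; every statement below is `[folklore]` bookkeeping over DISPLAYED letters; the
`[cite: …]` tags are TEXT LOCATIONS of the printed symbols only (ABSOLUTE RULE).

WHY THIS FILE (cell context; the OWNER t4-ne9-p1 g90's word W-4: «the abstract file is redundant at ONE step and load-bearing at k steps»).  Plan v10 §5 lists storey (D)'s letters (D-MP) `B5Eq129CoshSupersolution` ✓, (D-FS) `B5Eq129FreeResolventDecayedLetter` ✓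
(ne9-leaf-02), (D-P) `B9Eq324PenaltyBlockLocal` (ne9-leaf-03), (D-E) `B9Eq342BlockDecayWeightedSum` ✓ (this lineage), the abstract weighted bootstrap
`B9Eq342SupNormBootstrapWeighted` ✓ (OWNER) ∕ `…WeightedChain` ✓ (ne9-leaf-02, `k` dominations), and leaves (D-A) = the assembly at print's `G′(U)`.  Between the
abstract bootstrap (whose data letter `‖f y‖ + ‖q y‖ ≤ s·λ·W y` and free value `φ_k(x₀)` are displayed) and the instance there is one letters-level
composition — steps 2–5 of ne9-leaf-02 g71's `D-ASSEMBLY-NOTE.md`: the data letter FROM the support of `f`, the block-local penalty and the block decay; the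
free value FROM the decayed free letter and the (D-E) bracket; `‖f‖ ≤ √μ·F`.  This file IS that composition, over an abstract (K1) block family, so that the
instance reads `G := G′(U)` (`B9Eq3119DeltaPiCarrier.GpOfU`, Kato form as in `B9Eq342GreenPrimeSupBound.norm_GpOfU_apply_le`), `hdec :=`
`B9Eq349ConjugatedGreenBlockDecay.exists_block_decay_Gp` (source block first — the lattice § below keeps that orientation), `hq :=`
`B9Eq324PenaltyBlockLocal.norm_laplacePrimeA_sub_covLaplace_apply_le_block(_diagonal)`, `hμ :=` its `norm_block_le_sqrt_mul`, `hsup`∕`hx₀` := the (D-MP) `cosh`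
weight transported to `TSite` (`B5Eq129CoshSupersolution.weight_supersolution`, `weight_factor_centre`), `hW :=` `B9Eq342CoshWeightBlockDistance.exp_blockDist_le_weight_of_prod_cosh`
(`κ₁ = aL`, `M = 2e^{a(L−1)}`), `hFS :=` (D-FS) `chain_apply_le_weighted` transported to `TSite` (the `k`-chain twin of the OWNER's `fs_tsite_of_tor_sumElim`),
with `C₃ = √(ḡ_k·λ^{−k}∕c₀)`, `k ≥ d` for a level-free `ḡ_k` (`B5Eq129FreeResolventZoneSumLetters`).

WHAT IS PROVED (sorry-free; proof lane — 0 `def`; [folklore]).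
* §1 (`WL2 𝕜 w V`, (K1) block family `P`∕`hP` over `π : X → Y`, pseudo-metric `δ` nonneg + triangle, weighted graph `nbr`∕`ω ≥ 0`, contractive transporters `T`):
  `block_apply_eq_self_of_support` (`f` supported in the block `v` ⟹ `P_v f = f`); `data_le_weight` — THE WEIGHTED DATA LETTER INHABITED:
  `‖f y‖ + ‖q y‖ ≤ s·(λW y)` with `s = M·e^{−aδ(π x₀,v)}·(F + p₂C)∕λ` (`C = C_E‖f‖` for `u = Gf`); `sqrt_bracket_le` — `√(Σ_y w y‖u y‖²∕W y) ≤ √(MS)·C_E·‖f‖·e^{−aδ(π x₀,v)}`;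
  **`norm_apply_le_decay_of_letters`** — the displayed bound above (the WK chain from `exists_scalar_chain`, `norm_le_of_kato_bootstrap_weighted_chain_centre`).
* §2 (lattice `X = T_{Lm}`, `Y = T_m`, `π = blockCoord L m`, `δ = d_m`, weight `c₀`; block decay SOURCE-FIRST `e^{−κ·d_m(v,y)}` = `exists_block_decay_Gp`'s shape
  verbatim; `S = latticeConst d (κ₁ − 2a)` by `B4Sect5Torus.torusSum_le`): **`norm_apply_le_decay_of_letters_lattice`** — VOLUME-FREE constants.
HONEST SCOPE.  Composition over DISPLAYED letters; the instance at `G′(U)` (the OWNER's (D-A)), the `Tor ↔ TSite` transports of (D-MP)∕(D-FS), the window of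
`exists_block_decay_Gp` and every numerical value are NOT here; VALUE row only — no ∇-row, no Hölder norms; `B₀` crude.  NOT summit progress (cell pub-balaban:
NE9 NOT PRINTED ∕ NOT PROVED; «NE9 ⇐ the named binders»; row WALLED ON A MODEL (O-NE9-1; #5 UNRULED); spine PROVED 0∕9; rung (B)+1 finite T⁴ — NOT infinite
volume, NOT mass gap, NOT BetaPertH, NOT Clay).  HONEST DEPENDENCY (cell line): continuum YM on T⁴ ⇐ BetaPertH ∧ nine spine estimates (0/9 proved); BetaPertH ⇐
(D1) ∧ (D4) ∧ CAP+tail; G-an2-4 gates asym, D1 and NE2/3/4.  NEW file importing `B9Eq342BlockDecayWeightedSum` + `B9Eq342SupNormBootstrapWeightedChain` only;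
nothing modified.  Net new unproved facts: 0.
-/

noncomputable section

open scoped BigOperators

namespace Literature.MathematicalPhysics.QuantumFieldTheory.Balaban1983to89.B9Eq342SupNormDecayFromBlockDecay

open B4Sect5Torus (TSite tdist tdist_symm tdist_triangle tdist_nonneg torusSum_le)
open B4Sect5Proof (latticeConst)
open B9Eq311L2Pairing (WL2)
open B9Eq319QprimeTorus (fineP blockCoord)
open B9Eq342BlockDecayWeightedSum (norm_block_apply_le_of_block_decay norm_block_apply_le_weight norm_apply_le_weight_of_support
  weighted_sum_norm_sq_le_of_block_decay_op)
open B9Eq342SupNormBootstrapWeightedChain (exists_scalar_chain norm_le_of_kato_bootstrap_weighted_chain_centre)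

/-! ## §1 The composition over an abstract (K1) block family -/

section Blocks

variable {𝕜 : Type*} [RCLike 𝕜] {X Y : Type*} [Fintype X] [Fintype Y] [DecidableEq Y] {w : X → ℝ} [Fact (∀ x, 0 < w x)]
  {V : Type*} [NormedAddCommGroup V] [InnerProductSpace 𝕜 V]
  {π : X → Y} {P : Y → WL2 𝕜 w V →L[𝕜] WL2 𝕜 w V}
  (hP : ∀ (y : Y) (f : WL2 𝕜 w V) (x : X), WL2.equiv 𝕜 w V (P y f) x = if π x = y then WL2.equiv 𝕜 w V f x else 0)
  {δ : Y → Y → ℝ} (hδ0 : ∀ y y', 0 ≤ δ y y') (hδt : ∀ u y v, δ u v ≤ δ u y + δ y v)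

include hP in
omit [Fintype Y] in
/-- **A DATUM SUPPORTED IN ONE BLOCK IS ITS OWN BLOCK COMPONENT**: `f(x) = 0` unless `π x = v` ⟹ `P_v f = f` (print's «supp λ ⊂ Δ(y′)»).
[folklore] [cite: Balaban1985BackgroundPropagators, Thm 3.1 (3.42) p.397, (3.49) p.399] -/
theorem block_apply_eq_self_of_support {f : WL2 𝕜 w V} {v : Y} (hfv : ∀ x, π x ≠ v → WL2.equiv 𝕜 w V f x = 0) : P v f = f := by
  apply (WL2.equiv 𝕜 w V).injective
  funext x
  rw [hP]
  split_ifs with h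
  · rfl
  · exact (hfv x h).symm

include hδ0 hδt in
omit [Fintype Y] [DecidableEq Y] in
/-- **THE WEIGHTED DATA LETTER INHABITED** (step 2 of storey (D)): a source `f` supported in the block `v` with `‖f(y)‖ ≤ F`, a block-local penalty
`‖q(y)‖ ≤ p₂‖P_{π y}u‖`, the block decay of `u` from `v` (`‖P_y u‖ ≤ C·e^{−κδ(y,v)}`, `0 ≤ C`) and a weight `W > 0` with `e^{κ₁δ(π x₀,π y)} ≤ M·W(y)`
give, for every rate `0 ≤ a ≤ κ`, `a ≤ κ₁` and every `λ > 0`, `‖f y‖ + ‖q y‖ ≤ s·(λ·W y)` with `s = M·e^{−aδ(π x₀,v)}·(F + p₂C)∕λ` — the `hdata` of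
`B9Eq342SupNormBootstrapWeighted(Chain)`, DECAYING in the distance from the output block to the source block. [folklore]
[cite: Balaban1985BackgroundPropagators, Thm 3.1 (3.42) p.397, (3.49) p.399] -/
theorem data_le_weight {f u : WL2 𝕜 w V} {v : Y} (hfv : ∀ x, π x ≠ v → WL2.equiv 𝕜 w V f x = 0)
    {F : ℝ} (hF0 : 0 ≤ F) (hF : ∀ x, ‖WL2.equiv 𝕜 w V f x‖ ≤ F)
    {q : X → V} {p₂ : ℝ} (hp₂ : 0 ≤ p₂) (hq : ∀ x, ‖q x‖ ≤ p₂ * ‖P (π x) u‖)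
    {C κ : ℝ} (hC : 0 ≤ C) (hblk : ∀ y, ‖P y u‖ ≤ C * Real.exp (-(κ * δ y v)))
    (x₀ : X) {W : X → ℝ} (hW0 : ∀ x, 0 < W x) {M κ₁ : ℝ} (hM : 0 ≤ M) (hW : ∀ x, Real.exp (κ₁ * δ (π x₀) (π x)) ≤ M * W x)
    {a : ℝ} (ha : 0 ≤ a) (haκ : a ≤ κ) (haκ₁ : a ≤ κ₁) {lam : ℝ} (hlam : 0 < lam) (y : X) :
    ‖WL2.equiv 𝕜 w V f y‖ + ‖q y‖ ≤
      M * Real.exp (-(a * δ (π x₀) v)) * (F + p₂ * C) / lam * (lam * W y) := by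
  -- the weight dominates the slower exponential too
  have hWa : ∀ x, Real.exp (a * δ (π x₀) (π x)) ≤ M * W x := fun x =>
    (Real.exp_le_exp.2 (mul_le_mul_of_nonneg_right haκ₁ (hδ0 _ _))).trans (hW x)
  have h1 : ‖WL2.equiv 𝕜 w V f y‖ ≤ F * M * Real.exp (-(a * δ (π x₀) v)) * W y :=
    norm_apply_le_weight_of_support hfv hF0 hF (π x₀) (fun x => (hW0 x).le) hM hWa y
  have h2 : ‖P (π y) u‖ ≤ C * M * Real.exp (-(a * δ (π x₀) v)) * W y :=
    norm_block_apply_le_weight hδ0 hδt hC hblk (π x₀) ha haκ hWa y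
  have h3 : ‖q y‖ ≤ p₂ * (C * M * Real.exp (-(a * δ (π x₀) v)) * W y) := (hq y).trans (mul_le_mul_of_nonneg_left h2 hp₂)
  have e : M * Real.exp (-(a * δ (π x₀) v)) * (F + p₂ * C) / lam * (lam * W y) =
      F * M * Real.exp (-(a * δ (π x₀) v)) * W y + p₂ * (C * M * Real.exp (-(a * δ (π x₀) v)) * W y) := by
    rw [div_mul_eq_mul_div, mul_div_assoc, mul_div_cancel_left₀ _ hlam.ne']
    ring
  rw [e]
  exact add_le_add h1 h3

include hP hδ0 hδt in
/-- **THE SQUARE ROOT OF THE (D-E) BRACKET** (step 4): `u = Gf`, `P_v f = f`, `‖P_y∘G∘P_v‖ ≤ C_E e^{−κδ(y,v)}` (`0 ≤ C_E`), `W > 0` with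
`e^{κ₁δ(π x₀,π x)} ≤ M·W x` (`0 ≤ M`), `0 ≤ a ≤ κ`, `Σ_{y′}e^{−(κ₁−2a)δ(y,y′)} ≤ S` ⟹ `√(Σ_y w y‖u y‖²∕W y) ≤ √(M·S)·C_E·‖f‖·e^{−aδ(π x₀,v)}`.
[folklore] [cite: Balaban1985BackgroundPropagators, Thm 3.1 (3.42) p.397, (3.49) p.399, p.415] -/
theorem sqrt_bracket_le (G : WL2 𝕜 w V →L[𝕜] WL2 𝕜 w V) {f : WL2 𝕜 w V} {v : Y} (hfP : P v f = f)
    {CE κ : ℝ} (hCE : 0 ≤ CE) (hdec : ∀ y, ‖P y ∘L G ∘L P v‖ ≤ CE * Real.exp (-(κ * δ y v)))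
    (x₀ : X) {W : X → ℝ} (hW0 : ∀ x, 0 < W x) {M κ₁ : ℝ} (hM : 0 ≤ M) (hW : ∀ x, Real.exp (κ₁ * δ (π x₀) (π x)) ≤ M * W x)
    {a S : ℝ} (ha : 0 ≤ a) (haκ : a ≤ κ) (hS : ∀ y, ∑ y', Real.exp (-((κ₁ - 2 * a) * δ y y')) ≤ S) :
    Real.sqrt (∑ y, w y * ‖WL2.equiv 𝕜 w V (G f) y‖ ^ 2 / W y) ≤
      Real.sqrt (M * S) * CE * ‖f‖ * Real.exp (-(a * δ (π x₀) v)) := by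
  have hS0 : 0 ≤ S := (Finset.sum_nonneg fun y' _ => (Real.exp_pos _).le).trans (hS (π x₀))
  have hbr := weighted_sum_norm_sq_le_of_block_decay_op hP hδ0 hδt G hfP hdec (π x₀) hW0 hM hW (κ' := 2 * a)
    (by positivity) (by linarith) hS
  set E : ℝ := Real.exp (-(a * δ (π x₀) v)) with hE_def
  have hE2 : Real.exp (-(2 * a * δ (π x₀) v)) = E ^ 2 := by
    rw [hE_def, sq, ← Real.exp_add]; congr 1; ring
  have hsq : Real.sqrt (M * S) ^ 2 = M * S := Real.sq_sqrt (mul_nonneg hM hS0)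
  have hrhs : M * (CE * ‖f‖) ^ 2 * S * Real.exp (-(2 * a * δ (π x₀) v)) = (Real.sqrt (M * S) * CE * ‖f‖ * E) ^ 2 := by
    rw [hE2]
    calc M * (CE * ‖f‖) ^ 2 * S * E ^ 2 = M * S * (CE * ‖f‖) ^ 2 * E ^ 2 := by ring
      _ = Real.sqrt (M * S) ^ 2 * (CE * ‖f‖) ^ 2 * E ^ 2 := by rw [hsq]
      _ = (Real.sqrt (M * S) * CE * ‖f‖ * E) ^ 2 := by ring
  have h0 : 0 ≤ Real.sqrt (M * S) * CE * ‖f‖ * E := by positivity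
  calc Real.sqrt (∑ y, w y * ‖WL2.equiv 𝕜 w V (G f) y‖ ^ 2 / W y)
      ≤ Real.sqrt ((Real.sqrt (M * S) * CE * ‖f‖ * E) ^ 2) := Real.sqrt_le_sqrt (hbr.trans hrhs.le)
    _ = Real.sqrt (M * S) * CE * ‖f‖ * E := Real.sqrt_sq h0

include hP hδ0 hδt in
/-- **THE DECAYED VALUE ROW FROM THE LETTERS.**  Sites `X` with `L²`-weight `w > 0`, blocks `π : X → Y` with the (K1) family `P` (letter `hP`) and a
pseudo-metric `δ`; a weighted graph `nbr`, `ω ≥ 0` with contractive transporters `T` and a mass `m₀ > 0`; a supersolution weight `λW ≤ (L₀+m₀)W`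
(`0 < λ`, `0 < W`, `W x₀ = 1`) dominating `e^{κ₁δ(π x₀,π x)} ≤ M·W x`; an operator `G` with the BLOCK DECAY `‖P_y∘G∘P_v‖ ≤ C_E e^{−κδ(y,v)}` from the
source block `v`; a source `f` supported in `v` with `‖f(x)‖ ≤ F`, `‖f‖ ≤ √μ·F`; the solution `u = Gf` of `Σ_j ω_{xj}(u(x) − T_{xj}u(nbr x j)) = f(x) − q(x)`
with a BLOCK-LOCAL penalty `‖q(x)‖ ≤ p₂‖P_{π x}u‖`; the DECAYED FREE LETTER at `x₀` for `k`-chains (`φ₀ ≥ 0`, `(L₀+m₀)φ_{j+1} = φ_j` ⟹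
`φ_k(x₀) ≤ C₃√(Σ_y w y φ₀(y)²∕W y)`); rates `0 ≤ a ≤ κ`, `a ≤ κ₁`, `Σ_{y′}e^{−(κ₁−2a)δ(y,y′)} ≤ S`.  THEN
`‖u(x₀)‖ ≤ (M(1 + p₂C_E√μ)∕λ·Σ_{l<k}(m₀∕λ)^l + m₀^k·C₃·C_E·√(MS)·√μ)·e^{−aδ(π x₀,v)}·F` — print's «|(G′(U)λ)(x)| ≤ B₀e^{−δ₀d(y,y′)}|λ|, supp λ ⊂ Δ(y′)»
SHAPE, every letter displayed. [folklore] [cite: Balaban1985BackgroundPropagators, Thm 3.1 (3.42) p.397, (3.39) p.397, (3.49) p.399, p.415] -/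
theorem norm_apply_le_decay_of_letters {J : Type*} [Fintype J] (nbr : X → J → X) (ω : X → J → ℝ) (hω : ∀ x j, 0 ≤ ω x j)
    (T : X → J → V →ₗ[𝕜] V) (hT : ∀ x j z, ‖T x j z‖ ≤ ‖z‖) {m₀ : ℝ} (hm₀ : 0 < m₀)
    {W : X → ℝ} (hW0 : ∀ x, 0 < W x) {lam : ℝ} (hlam : 0 < lam)
    (hsup : ∀ x, lam * W x ≤ ∑ j, ω x j * (W x - W (nbr x j)) + m₀ * W x) {x₀ : X} (hx₀ : W x₀ = 1)
    {M κ₁ : ℝ} (hM : 0 ≤ M) (hW : ∀ x, Real.exp (κ₁ * δ (π x₀) (π x)) ≤ M * W x)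
    (G : WL2 𝕜 w V →L[𝕜] WL2 𝕜 w V) {f : WL2 𝕜 w V} {v : Y} (hfv : ∀ x, π x ≠ v → WL2.equiv 𝕜 w V f x = 0)
    {F : ℝ} (hF0 : 0 ≤ F) (hF : ∀ x, ‖WL2.equiv 𝕜 w V f x‖ ≤ F) {μ : ℝ} (hμ : ‖f‖ ≤ Real.sqrt μ * F)
    {CE κ : ℝ} (hCE : 0 ≤ CE) (hdec : ∀ y, ‖P y ∘L G ∘L P v‖ ≤ CE * Real.exp (-(κ * δ y v)))
    {q : X → V} (hu : ∀ x, ∑ j, (ω x j : 𝕜) • (WL2.equiv 𝕜 w V (G f) x - T x j (WL2.equiv 𝕜 w V (G f) (nbr x j))) =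
      WL2.equiv 𝕜 w V f x - q x)
    {p₂ : ℝ} (hp₂ : 0 ≤ p₂) (hq : ∀ x, ‖q x‖ ≤ p₂ * ‖P (π x) (G f)‖)
    {k : ℕ} {C₃ : ℝ} (hC₃ : 0 ≤ C₃)
    (hFS : ∀ φ : ℕ → X → ℝ, (∀ y, 0 ≤ φ 0 y) →
      (∀ j < k, ∀ x, ∑ i, ω x i * (φ (j + 1) x - φ (j + 1) (nbr x i)) + m₀ * φ (j + 1) x = φ j x) →
      φ k x₀ ≤ C₃ * Real.sqrt (∑ y, w y * φ 0 y ^ 2 / W y))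
    {a S : ℝ} (ha : 0 ≤ a) (haκ : a ≤ κ) (haκ₁ : a ≤ κ₁) (hS : ∀ y, ∑ y', Real.exp (-((κ₁ - 2 * a) * δ y y')) ≤ S) :
    ‖WL2.equiv 𝕜 w V (G f) x₀‖ ≤
      (M * (1 + p₂ * CE * Real.sqrt μ) / lam * ∑ l ∈ Finset.range k, (m₀ / lam) ^ l +
        m₀ ^ k * C₃ * CE * Real.sqrt (M * S) * Real.sqrt μ) * Real.exp (-(a * δ (π x₀) v)) * F := by
  set u : X → V := WL2.equiv 𝕜 w V (G f) with hu_def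
  set E : ℝ := Real.exp (-(a * δ (π x₀) v)) with hE_def
  have hE0 : 0 < E := Real.exp_pos _
  -- the source is its own block component; block decay of the solution
  have hfP : P v f = f := block_apply_eq_self_of_support hP hfv
  have hblk : ∀ y, ‖P y (G f)‖ ≤ CE * ‖f‖ * Real.exp (-(κ * δ y v)) := fun y =>
    calc ‖P y (G f)‖ ≤ CE * Real.exp (-(κ * δ y v)) * ‖f‖ := norm_block_apply_le_of_block_decay (δ := δ) G hfP hdec y
      _ = CE * ‖f‖ * Real.exp (-(κ * δ y v)) := by ring
  -- the weighted data letter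
  have hs : 0 ≤ M * E * (F + p₂ * (CE * ‖f‖)) / lam := by positivity
  have hdata : ∀ y, ‖WL2.equiv 𝕜 w V f y‖ + ‖q y‖ ≤ M * E * (F + p₂ * (CE * ‖f‖)) / lam * (lam * W y) :=
    data_le_weight hδ0 hδt hfv hF0 hF hp₂ hq (by positivity) hblk x₀ hW0 hM hW ha haκ haκ₁ hlam
  -- the `k`-chain of the solution and the weighted bootstrap at the centre
  obtain ⟨φ, hφ0, hφ⟩ := exists_scalar_chain nbr ω hω hm₀ (fun y => ‖u y‖) k
  have hφ0' : ∀ y, φ 0 y = ‖u y‖ := fun y => by rw [hφ0]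
  have hWK := norm_le_of_kato_bootstrap_weighted_chain_centre nbr ω hω T hT hm₀ hlam hsup hu hs hdata hφ0' hφ hx₀
  -- the free value by the decayed free letter and the (D-E) bracket
  have hφk : φ k x₀ ≤ C₃ * Real.sqrt (∑ y, w y * ‖u y‖ ^ 2 / W y) := by
    have h := hFS φ (fun y => by rw [hφ0']; exact norm_nonneg _) hφ
    simpa only [hφ0'] using h
  have hbr : Real.sqrt (∑ y, w y * ‖u y‖ ^ 2 / W y) ≤ Real.sqrt (M * S) * CE * ‖f‖ * E :=
    sqrt_bracket_le hP hδ0 hδt G hfP hCE hdec x₀ hW0 hM hW ha haκ hS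
  -- `‖f‖ ≤ √μ·F`
  have hMS : 0 ≤ Real.sqrt (M * S) := Real.sqrt_nonneg _
  have hsum0 : 0 ≤ ∑ l ∈ Finset.range k, (m₀ / lam) ^ l := Finset.sum_nonneg fun l _ => by positivity
  have hA : M * E * (F + p₂ * (CE * ‖f‖)) / lam ≤ M * E * (F + p₂ * (CE * (Real.sqrt μ * F))) / lam := by
    gcongr
  have hB : φ k x₀ ≤ C₃ * (Real.sqrt (M * S) * CE * (Real.sqrt μ * F) * E) := by
    refine hφk.trans (mul_le_mul_of_nonneg_left (hbr.trans ?_) hC₃)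
    gcongr
  calc ‖u x₀‖ ≤ M * E * (F + p₂ * (CE * ‖f‖)) / lam * ∑ l ∈ Finset.range k, (m₀ / lam) ^ l + m₀ ^ k * φ k x₀ := hWK
    _ ≤ M * E * (F + p₂ * (CE * (Real.sqrt μ * F))) / lam * ∑ l ∈ Finset.range k, (m₀ / lam) ^ l +
          m₀ ^ k * (C₃ * (Real.sqrt (M * S) * CE * (Real.sqrt μ * F) * E)) :=
        add_le_add (mul_le_mul_of_nonneg_right hA hsum0) (mul_le_mul_of_nonneg_left hB (pow_nonneg hm₀.le k))
    _ = (M * (1 + p₂ * CE * Real.sqrt μ) / lam * ∑ l ∈ Finset.range k, (m₀ / lam) ^ l +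
          m₀ ^ k * C₃ * CE * Real.sqrt (M * S) * Real.sqrt μ) * E * F := by ring

end Blocks

/-! ## §2 The lattice letters: `X = T_{Lm}`, `Y = T_m`, `π = blockCoord`, `δ = d_m`, block decay SOURCE-FIRST; VOLUME-FREE constants -/

section Lattice

variable {𝕜 : Type*} [RCLike 𝕜] {d : ℕ} {L : ℕ} {m : Fin d → ℕ} {c₀ : ℝ} [Fact (0 < c₀)]
  {V : Type*} [NormedAddCommGroup V] [InnerProductSpace 𝕜 V]
  {P : TSite d m → WL2 𝕜 (fun _ : TSite d (fineP L m) => c₀) V →L[𝕜] WL2 𝕜 (fun _ : TSite d (fineP L m) => c₀) V}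
  (hP : ∀ (y : TSite d m) (f : WL2 𝕜 (fun _ : TSite d (fineP L m) => c₀) V) (x : TSite d (fineP L m)),
    WL2.equiv 𝕜 (fun _ : TSite d (fineP L m) => c₀) V (P y f) x =
      if blockCoord L m x = y then WL2.equiv 𝕜 (fun _ : TSite d (fineP L m) => c₀) V f x else 0)

include hP in
/-- **THE DECAYED VALUE ROW FROM THE LETTERS, ON THE LATTICE, VOLUME-FREE.**  As `norm_apply_le_decay_of_letters` with `π = blockCoord L m`, `δ = d_m`
(`B4Sect5Torus.tdist`), the block decay in the chain's SOURCE-FIRST orientation `‖P_y∘G∘P_v‖ ≤ C_E·e^{−κ·d_m(v,y)}` (VERBATIM the conclusion shape of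
`B9Eq349ConjugatedGreenBlockDecay.exists_block_decay_Gp`), the weight domination `e^{κ₁·d_m(π x₀, π x)} ≤ M·W x` (inhabited by
`B9Eq342CoshWeightBlockDistance.exp_blockDist_le_weight_of_prod_cosh` with `κ₁ = aL`), and rates `0 ≤ a ≤ κ`, `2a < κ₁`:
`‖u(x₀)‖ ≤ (M(1 + p₂C_E√μ)∕λ·Σ_{l<k}(m₀∕λ)^l + m₀^k·C₃·C_E·√(M·K_d(κ₁−2a))·√μ)·e^{−a·d_m(π x₀, v)}·F`, `K_d = latticeConst` — independent of the volume `m`.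
[folklore] [cite: Balaban1985BackgroundPropagators, Thm 3.1 (3.42) p.397, (3.39) p.397, (3.49) p.399, p.415] -/
theorem norm_apply_le_decay_of_letters_lattice (hm : ∀ i, 1 ≤ m i) {J : Type*} [Fintype J]
    (nbr : TSite d (fineP L m) → J → TSite d (fineP L m)) (ω : TSite d (fineP L m) → J → ℝ) (hω : ∀ x j, 0 ≤ ω x j)
    (T : TSite d (fineP L m) → J → V →ₗ[𝕜] V) (hT : ∀ x j z, ‖T x j z‖ ≤ ‖z‖) {m₀ : ℝ} (hm₀ : 0 < m₀)
    {W : TSite d (fineP L m) → ℝ} (hW0 : ∀ x, 0 < W x) {lam : ℝ} (hlam : 0 < lam)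
    (hsup : ∀ x, lam * W x ≤ ∑ j, ω x j * (W x - W (nbr x j)) + m₀ * W x) {x₀ : TSite d (fineP L m)} (hx₀ : W x₀ = 1)
    {M κ₁ : ℝ} (hM : 0 ≤ M) (hW : ∀ x, Real.exp (κ₁ * tdist m (blockCoord L m x₀) (blockCoord L m x)) ≤ M * W x)
    (G : WL2 𝕜 (fun _ : TSite d (fineP L m) => c₀) V →L[𝕜] WL2 𝕜 (fun _ : TSite d (fineP L m) => c₀) V)
    {f : WL2 𝕜 (fun _ : TSite d (fineP L m) => c₀) V} {v : TSite d m}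
    (hfv : ∀ x, blockCoord L m x ≠ v → WL2.equiv 𝕜 (fun _ : TSite d (fineP L m) => c₀) V f x = 0)
    {F : ℝ} (hF0 : 0 ≤ F) (hF : ∀ x, ‖WL2.equiv 𝕜 (fun _ : TSite d (fineP L m) => c₀) V f x‖ ≤ F) {μ : ℝ} (hμ : ‖f‖ ≤ Real.sqrt μ * F)
    {CE κ : ℝ} (hCE : 0 ≤ CE) (hdec : ∀ y, ‖P y ∘L G ∘L P v‖ ≤ CE * Real.exp (-(κ * tdist m v y)))
    {q : TSite d (fineP L m) → V}
    (hu : ∀ x, ∑ j, (ω x j : 𝕜) • (WL2.equiv 𝕜 (fun _ : TSite d (fineP L m) => c₀) V (G f) x -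
        T x j (WL2.equiv 𝕜 (fun _ : TSite d (fineP L m) => c₀) V (G f) (nbr x j))) =
      WL2.equiv 𝕜 (fun _ : TSite d (fineP L m) => c₀) V f x - q x)
    {p₂ : ℝ} (hp₂ : 0 ≤ p₂) (hq : ∀ x, ‖q x‖ ≤ p₂ * ‖P (blockCoord L m x) (G f)‖)
    {k : ℕ} {C₃ : ℝ} (hC₃ : 0 ≤ C₃)
    (hFS : ∀ φ : ℕ → TSite d (fineP L m) → ℝ, (∀ y, 0 ≤ φ 0 y) →
      (∀ j < k, ∀ x, ∑ i, ω x i * (φ (j + 1) x - φ (j + 1) (nbr x i)) + m₀ * φ (j + 1) x = φ j x) →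
      φ k x₀ ≤ C₃ * Real.sqrt (∑ y, c₀ * φ 0 y ^ 2 / W y))
    {a : ℝ} (ha : 0 ≤ a) (haκ : a ≤ κ) (h2a : 2 * a < κ₁) :
    ‖WL2.equiv 𝕜 (fun _ : TSite d (fineP L m) => c₀) V (G f) x₀‖ ≤
      (M * (1 + p₂ * CE * Real.sqrt μ) / lam * ∑ l ∈ Finset.range k, (m₀ / lam) ^ l +
        m₀ ^ k * C₃ * CE * Real.sqrt (M * latticeConst d (κ₁ - 2 * a)) * Real.sqrt μ) *
        Real.exp (-(a * tdist m (blockCoord L m x₀) v)) * F := by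
  have haκ₁ : a ≤ κ₁ := by linarith
  have hdec' : ∀ y, ‖P y ∘L G ∘L P v‖ ≤ CE * Real.exp (-(κ * tdist m y v)) := fun y => by
    have h := hdec y; rwa [tdist_symm hm v y] at h
  exact norm_apply_le_decay_of_letters (P := P) (π := blockCoord L m) (δ := tdist m) hP (tdist_nonneg m) (tdist_triangle hm)
    nbr ω hω T hT hm₀ hW0 hlam hsup hx₀ hM hW G hfv hF0 hF hμ hCE hdec' hu hp₂ hq hC₃ hFS ha haκ haκ₁
    (fun y => torusSum_le d hm (sub_pos.mpr h2a) y)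

end Lattice

end Literature.MathematicalPhysics.QuantumFieldTheory.Balaban1983to89.B9Eq342SupNormDecayFromBlockDecay

end
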